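import Summits.QuantumFields.YangMills.Theorems.BalabanUVNodesN22KernelLimitOfTwoPointGenerating
import Summits.QuantumFields.YangMills.Theorems.BalabanUVNodesN22KnitTwoConstants

/-!
# NODE N22 (NE9) — THE (1.21)-EXISTENCE HALF, CHART-FREE: the kernel-level cross-volume law (S≈) from a REAL-PROBE law (G≈ℝ) on the finite-volume (2.13) terms at Bałaban's
# own probe families `U(exp iB)`, by a two-variable two-constants bound + the torus count + Cauchy (sequel to p615597 ∕ p616912)

Cell `pub-ymgap`, Track A (HUMAN RULING D-0062), WIDTH SEAT `dag-n22-w3` g4 on node n22 = NE9; `--kind proof --supports stmt-QuantumFields-20544 --as helper` (K3⁷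
`SpineGivenEndpointR13SepCoPH`, skeleton v5 941dddb108cbaacf), COUNT-NEUTRAL.  CLAIM-3 of this seat (pub-ymgap INBOX l.32110; self-located, own lineage = the existence half).

WHY.  After p615597 ∕ p616912 the existence half's ONE displayed structural law is (G≈): cross-volume closeness of the small-domain two-point COMPLEX generating functions on a bidisc —
stated THROUGH the prover-supplied complexified readings `Φ_{K,X}`.  This file removes the complexification from the LAW.  (G≈ℝ) «for `g ∈ W`, a level `k`, `(μ, ν, z)`: from a
threshold on, every colour `c` and all REAL `|a|, |b| ≤ r₂`, `‖Σ_{X ∈ lo k (K+1)} E^{(k+1)}_X(hist; emb_{K+1}(exp ρ(a·e_{μ,z,c} + b·e_{ν,0,c}))) − Σ_{X ∈ lo k K} E^{(k+1)}_X(hist;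
emb_K(exp ρ(a·e_{μ,z,c} + b·e_{ν,0,c})))‖ ≤ C r₀^K`» speaks ONLY of the finite-volume (2.13) terms at the real probe families — [I] p. 264 «Now we take a limit of these functions as
T^{(j+1)} ↗ Z^d» verbatim in type.  The complex-analytic input the Cauchy step needs — a uniform bound on the bidisc — is ENGINE OUTPUT: J30-v1.1's value half
`‖E_X(Φ z)‖ ≤ e·9·64·K₀(64,8)²·A·e^{−r₁ d(X)}` on `U`, summed over the torus catalogue by [II] (1.26) (`ineq126_torus`): `≤ Q·(cubes)⁴ ≤ Q·16L^{4m}·(L⁴)^K` (§1 `sum_exp_neg_torusTreeLen_filter_le`,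
§3 `domCount_pow_four_le`) — at most GEOMETRIC growth, which the two-constants interpolation absorbs for a small enough exponent `s`.

* §1 `norm_le_twoConstants_bidisc` — TWO complex variables: `h` holomorphic on the sup-norm ball `‖σ‖ < R` of `ℂ²`, `‖h‖ ≤ K` on the closed bidisc of radius `L < R`, REAL-FLAT `‖h(a,b)‖ ≤ ε`
  for real `|a|,|b| ≤ L` (`0 < ε ≤ K`, `s < 1`) ⟹ `‖h σ‖ ≤ (ε^{1−s}K^{s})^{1−s}K^{s}` for `‖σ‖ ≤ Ls∕4` — dag-n22-a's one-variable `N22KnitThreeLines.box_bound` (Hadamard three lines on a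
  disc, p425325's lineage) in the first variable at each real value of the second, then in the second at each point of the first box; `sum_exp_neg_torusTreeLen_filter_le` (the torus count).
* §2 `twoConstantsLetter_mono` ∕ `pow_rpow_comm` ∕ `twoConstantsLetter_geometric` (the letter `T(ε,K) = (ε^{1−s}K^{s})^{1−s}K^{s}` of geometric families is geometric: `T(C₁r₀^K, M₂μ^K) =
  T(C₁,M₂)·ρ_s^K`, `ρ_s = (r₀^{1−s}μ^{s})^{1−s}μ^{s}`); `abs_avg_polTensor_twoPoint_sub_le_of_realFlat` — two volumes on the common plane from real flatness + a complex bound (§1 on the difference,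
  then p615597's `abs_avg_polTensor_twoPoint_sub_le` = J28's Cauchy bound on the bidisc of radius `Ls∕4`).
* SEQUEL FILE `…N22KernelLimitOfRealTwoPointLetters` (split for the 400-line rule): ★★ `approxStable_of_realTwoPoint` — (G≈ℝ) ⟹ (S≈) VERBATIM (the `hS` binder of p607522 ∕ p611742) in
  the towers at the rate `ρ_s = (r₀^{1−s}(L⁴)^{s})^{1−s}(L⁴)^{s}`, any `s ∈ ]0,1[`, and the W1-19b letter editions keyed on (G≈ℝ).  THIS file is the generic half (§1–§2).

CONSUMES BY NAME (nothing re-declared): p615597 `sum_polScalar_eq_avg_polTensor_twoPointGenerating` ∕ `differentiableOn_twoPointGenerating` ∕ `abs_avg_polTensor_twoPoint_sub_le`; dag-n22-a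
`N22KnitThreeLines.box_bound` (p425325 lineage, `…N22KnitTwoConstants` import); dag-n22-c J30-v1.1 `differentiableOn_and_norm_clusterStepE_comp_le_of_activityHol`; Literature `TreeLengthTorus`
(`ineq126_torus`, `card_tcube`, `tsys`∕`tcubeSys`), `B12TreeDecay` (`sum_touches_le`, `K₀`, `kappa₀`), `T4Family.sitesPerDir_eq`, def-T `Sect2.domCount`∕`domSys`, W1 `ClusterStep.{E, H, Bound238}`,
def-B `polScalar`∕`polTensor`∕`expChart`.

HONEST FRAMING (binding).  Count-neutral helper; THEOREMS ONLY (0 def, 0 sorry, standard axioms); classical one∕two-variable complex analysis + bookkeeping.  (G≈ℝ) is a DISPLAYED HYPOTHESIS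
with its owner (NODE A ∕ def-W1: the thermodynamic convergence near the window of the finite-volume local terms — (1.7)-locality + the p. 282 tails; NOT typed here), as are W1's (2.38)
value slot at the towers of record (N10 ∕ NODE A), activity holomorphy through the complexified minimizer reading and the reading itself ([I] p. 264, [II] p. 15 — NODE A), the p. 282
site-weight tails, Road-1 numerals.  (1.21)'s existence for the terms OF RECORD is NOT proved; nothing of Bałaban's is constructed or asserted; N22 NOT discharged (typed 28∕28 · discharged
5∕27 UNMOVED); K3⁷ OPEN, NOT claimed; no count claim (the chair's single count line is the only count); one finite 𝕋⁴ programme at fixed ε — R4 closes the CONDITIONAL rung `BalabanLadder.UV`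
only; NOTHING about the continuum limit, ℝ⁴, infinite volume, OS axioms, a mass gap or the Clay problem is proved or claimed by any of this.  No decl carries a cite tag (Summit side); TYPES
only: [I] = [Balaban1987RG1] (1.7) p. 261, (1.18) p. 263, (1.20)–(1.21) p. 264, p. 282; [II] = [Balaban1988RG2Cluster] (1.26) p. 8, (2.13)–(2.14) pp. 14–15, (2.38) p. 20; [Chae1985] Ch. 15.
-/

noncomputable section

open Filter Topology Metric Set
open scoped BigOperators

namespace YMDAG.N22.AtKernels

open Literature.MathematicalPhysics.QuantumFieldTheory.Balaban1983to89
open Literature.MathematicalPhysics.QuantumFieldTheory.Balaban1983to89.B12PolarizationTensor120 (polTensor polComp expChart)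
open Literature.MathematicalPhysics.QuantumFieldTheory.Balaban1983to89.B12TreeDecay (K₀ kappa₀ K₀_pos kappa₀_nonneg)
open Literature.MathematicalPhysics.QuantumFieldTheory.Balaban1983to89.TreeLengthTorus (TPt torusTreeLen torusTreeLen_nonneg tsys tcubeSys ineq126_torus card_tcube)
open Summit.QuantumFields.YangMills.BalabanUVNodes.N22KnitThreeLines (box_bound)
open Literature.MathematicalPhysics.QuantumFieldTheory.Balaban1983to89.T4Continuum (T4Family)
open Literature.MathematicalPhysics.QuantumFieldTheory.Balaban1983to89.Node00 (polScalar polWindow siteOfInt PolLimitExists)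
open Literature.MathematicalPhysics.QuantumFieldTheory.Balaban1983to89.Node00.Sect2 (domCount domSys CPair)
open Literature.MathematicalPhysics.QuantumFieldTheory.Balaban1983to89.B14.Eq213MaximalDomains (side)
open Literature.MathematicalPhysics.QuantumFieldTheory.Balaban1983to89.Node00.W1 (ClusterTower ClusterStep)
open Literature.MathematicalPhysics.QuantumFieldTheory.Balaban1983to89.Node00.LocalizedSum17 (localizedSum ReadingMaps)
open Literature.MathematicalPhysics.QuantumFieldTheory.Balaban1983to89.Node00.U3OfKernels (histPrefix)
open Literature.MathematicalPhysics.QuantumFieldTheory.Balaban1983to89.Node00.U3KernelLetters (PolLimitsExist)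
open Literature.MathematicalPhysics.QuantumFieldTheory.Balaban1983to89.B12Decay510Torus (distCT nearT distCT_nonneg)
open YMDAG.N22.WindowOfLocalTerms (differentiableOn_and_norm_clusterStepE_comp_le_of_activityHol)

/-! ## §1 Two complex variables: the two-constants bound on a bidisc from REAL flatness; the torus count -/

section TwoConstants

/-- The slice maps `ζ ↦ (ζ, τ)` and `τ ↦ (ζ, τ)` of `ℂ²` are entire. [folklore] -/
theorem differentiable_vecCons_left (τ : ℂ) : Differentiable ℂ (fun ζ : ℂ => (![ζ, τ] : Fin 2 → ℂ)) :=
  differentiable_pi.2 fun i => by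
    fin_cases i
    · exact differentiable_id
    · exact differentiable_const _

/-- (companion) [folklore] -/
theorem differentiable_vecCons_right (ζ : ℂ) : Differentiable ℂ (fun τ : ℂ => (![ζ, τ] : Fin 2 → ℂ)) :=
  differentiable_pi.2 fun i => by
    fin_cases i
    · exact differentiable_const _
    · exact differentiable_id

/-- The sup norm of a pair. [folklore] -/
theorem norm_vecCons_le {ζ τ : ℂ} {R : ℝ} (hR : 0 ≤ R) (hζ : ‖ζ‖ ≤ R) (hτ : ‖τ‖ ≤ R) : ‖(![ζ, τ] : Fin 2 → ℂ)‖ ≤ R :=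
  (pi_norm_le_iff_of_nonneg hR).2 fun i => by fin_cases i <;> simpa

/-- (strict companion) [folklore] -/
theorem norm_vecCons_lt {ζ τ : ℂ} {R : ℝ} (hR : 0 < R) (hζ : ‖ζ‖ < R) (hτ : ‖τ‖ < R) : ‖(![ζ, τ] : Fin 2 → ℂ)‖ < R :=
  (pi_norm_lt_iff hR).2 fun i => by fin_cases i <;> simpa

/-- **THE TWO-CONSTANTS BOUND ON A BIDISC FROM REAL FLATNESS.**  `h` complex-differentiable on the (sup-norm) ball `‖σ‖ < R` of `ℂ²`, `‖h‖ ≤ K` on the closed bidisc of radius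
`L < R`, and REAL-FLAT: `‖h(a, b)‖ ≤ ε` for real `|a|, |b| ≤ L`, `0 < ε ≤ K`, `0 < s < 1`.  Then on the bidisc `‖σ‖ ≤ Ls∕4`:
`‖h σ‖ ≤ (ε^{1−s}K^{s})^{1−s}K^{s}` — dag-n22-a's one-variable `box_bound` (Hadamard three lines on a disc) in the first variable at every real value of the second, then in
the second variable at every point of the first box. [folklore] -/
theorem norm_le_twoConstants_bidisc (h : (Fin 2 → ℂ) → ℂ) {R L K ε s : ℝ} (hL : 0 < L) (hLR : L < R)
    (hh : DifferentiableOn ℂ h (ball 0 R)) (hK : ∀ σ ∈ closedBall (0 : Fin 2 → ℂ) L, ‖h σ‖ ≤ K)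
    (hflat : ∀ a b : ℝ, |a| ≤ L → |b| ≤ L → ‖h ![(a : ℂ), (b : ℂ)]‖ ≤ ε)
    (hε : 0 < ε) (hεK : ε ≤ K) (hs1 : s < 1) {σ : Fin 2 → ℂ} (hσ : ‖σ‖ ≤ L * s / 4) :
    ‖h σ‖ ≤ (ε ^ (1 - s) * K ^ s) ^ (1 - s) * K ^ s := by
  have hK0 : 0 < K := hε.trans_le hεK
  have hLs : L * s / 4 ≤ L / 2 := by nlinarith
  have hLsL : L * s / 4 ≤ L := by nlinarith
  -- step 1: flat in the first variable ⇒ small on the first box, at every real value of the second variable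
  have step1 : ∀ b : ℝ, |b| ≤ L → ∀ ζ : ℂ, |ζ.re| ≤ L / 2 → |ζ.im| ≤ L * s / 4 → ‖h ![ζ, (b : ℂ)]‖ ≤ ε ^ (1 - s) * K ^ s := by
    intro b hb ζ hre him
    have hbR : ‖(b : ℂ)‖ < R := by rw [Complex.norm_real, Real.norm_eq_abs]; linarith
    have hbL : ‖(b : ℂ)‖ ≤ L := by rw [Complex.norm_real, Real.norm_eq_abs]; exact hb
    have hG : DifferentiableOn ℂ (fun ζ : ℂ => h ![ζ, (b : ℂ)]) (ball (0 : ℂ) R) :=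
      hh.comp (differentiable_vecCons_left _).differentiableOn fun ζ hζ => by
        rw [mem_ball_zero_iff] at hζ ⊢
        exact norm_vecCons_lt (hL.trans hLR) hζ hbR
    have h1 := box_bound (c := 0) (G := fun ζ : ℂ => h ![ζ, (b : ℂ)]) hL hLR hG
      (fun z hz => by rw [sub_zero]; exact hK _ (mem_closedBall_zero_iff.2 (norm_vecCons_le hL.le (mem_closedBall_zero_iff.1 hz) hbL)))
      (fun η hη => by rw [sub_zero]; exact hflat η b hη hb) hε hεK hs1 hre him
    rwa [sub_zero] at h1
  -- step 2: at the first coordinate of `σ`, flat (by step 1) in the second variable ⇒ small at `σ`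
  have hσ0 : ‖σ 0‖ ≤ L * s / 4 := (norm_le_pi_norm σ 0).trans hσ
  have hσ1 : ‖σ 1‖ ≤ L * s / 4 := (norm_le_pi_norm σ 1).trans hσ
  have hre0 : |(σ 0).re| ≤ L / 2 := ((Complex.abs_re_le_norm _).trans hσ0).trans hLs
  have him0 : |(σ 0).im| ≤ L * s / 4 := (Complex.abs_im_le_norm _).trans hσ0
  have hre1 : |(σ 1).re| ≤ L / 2 := ((Complex.abs_re_le_norm _).trans hσ1).trans hLs
  have him1 : |(σ 1).im| ≤ L * s / 4 := (Complex.abs_im_le_norm _).trans hσ1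
  have hε₁ : 0 < ε ^ (1 - s) * K ^ s := mul_pos (Real.rpow_pos_of_pos hε _) (Real.rpow_pos_of_pos hK0 _)
  have hε₁K : ε ^ (1 - s) * K ^ s ≤ K := by
    calc ε ^ (1 - s) * K ^ s ≤ K ^ (1 - s) * K ^ s :=
          mul_le_mul_of_nonneg_right (Real.rpow_le_rpow hε.le hεK (by linarith)) (Real.rpow_nonneg hK0.le _)
      _ = K := by rw [← Real.rpow_add hK0]; norm_num
  have hG2 : DifferentiableOn ℂ (fun τ : ℂ => h ![σ 0, τ]) (ball (0 : ℂ) R) :=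
    hh.comp (differentiable_vecCons_right _).differentiableOn fun τ hτ => by
      rw [mem_ball_zero_iff] at hτ ⊢
      exact norm_vecCons_lt (hL.trans hLR) (by linarith) hτ
  have h2 := box_bound (c := 0) (G := fun τ : ℂ => h ![σ 0, τ]) hL hLR hG2
    (fun z hz => by rw [sub_zero]; exact hK _ (mem_closedBall_zero_iff.2 (norm_vecCons_le hL.le (by linarith) (mem_closedBall_zero_iff.1 hz))))
    (fun η hη => by rw [sub_zero]; exact step1 η hη (σ 0) hre0 him0) hε₁ hε₁K hs1 hre1 him1
  rw [sub_zero] at h2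
  have hσeq : (![σ 0, σ 1] : Fin 2 → ℂ) = σ := by funext i; fin_cases i <;> rfl
  simpa only [hσeq] using h2

/-- **THE TORUS COUNT**: on the torus catalogue `𝐃_j` of `N⁴` cubes, `Σ_{X ∈ 𝐃_j, p X} e^{−κ d_j(X)} ≤ N⁴·K₀(4·2⁴, 8)` for `κ ≥ κ₀(4·2⁴, 8)` and any class `p` — every domain lies
above one of its cubes (`sum_touches_le`) and [II] (1.26) on the torus (`ineq126_torus`) bounds each cube's share by `K₀`. [cite: Balaban1988RG2Cluster, (1.26) p.8] -/
theorem sum_exp_neg_torusTreeLen_filter_le (N : ℕ) [NeZero N] {κ : ℝ} (hκ : kappa₀ (4 * 2 ^ 4) (2 * 4) ≤ κ) (p : (tsys 4 N).Dom → Prop) [DecidablePred p] :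
    ∑ X ∈ Finset.univ.filter p, Real.exp (-(κ * torusTreeLen X.1)) ≤ (N : ℝ) ^ 4 * K₀ (4 * 2 ^ 4) (2 * 4) := by
  classical
  have hnn : ∀ X : (tsys 4 N).Dom, 0 ≤ Real.exp (-(κ * torusTreeLen X.1)) := fun X => Real.exp_nonneg _
  have hall : Finset.univ.filter (fun X : (tsys 4 N).Dom => ((tcubeSys 4 N).cubes X ∩ Finset.univ).Nonempty) = Finset.univ :=
    Finset.filter_true_of_mem fun X _ => by rw [Finset.inter_univ]; exact ((tcubeSys 4 N).connected X).1
  calc ∑ X ∈ Finset.univ.filter p, Real.exp (-(κ * torusTreeLen X.1))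
      ≤ ∑ X : (tsys 4 N).Dom, Real.exp (-(κ * torusTreeLen X.1)) :=
        Finset.sum_le_sum_of_subset_of_nonneg (Finset.filter_subset _ _) fun X _ _ => hnn X
    _ = ∑ X ∈ Finset.univ.filter (fun X : (tsys 4 N).Dom => ((tcubeSys 4 N).cubes X ∩ Finset.univ).Nonempty), Real.exp (-(κ * torusTreeLen X.1)) := by
        rw [hall]
    _ ≤ ∑ c ∈ (Finset.univ : Finset (tcubeSys 4 N).Cube), ∑ X ∈ (tcubeSys 4 N).above c, Real.exp (-(κ * torusTreeLen X.1)) :=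
        B12TreeDecay.sum_touches_le (tcubeSys 4 N) Finset.univ _ hnn
    _ ≤ ∑ c ∈ (Finset.univ : Finset (tcubeSys 4 N).Cube), K₀ (4 * 2 ^ 4) (2 * 4) :=
        Finset.sum_le_sum fun c _ => by
          have h := ineq126_torus 4 N hκ c
          simpa only [TreeLengthTorus.tsys_dj, neg_mul] using h
    _ = (N : ℝ) ^ 4 * K₀ (4 * 2 ^ 4) (2 * 4) := by
        rw [Finset.sum_const, Finset.card_univ, card_tcube, nsmul_eq_mul, Nat.cast_pow]

end TwoConstants


/-! ## §2 Algebra of the two-constants letters; two volumes compared on the common plane from REAL flatness -/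

section Algebra

/-- The two-constants letter `T(ε, K) = (ε^{1−s}K^{s})^{1−s}K^{s}` is monotone in both arguments (`0 ≤ ε ≤ ε′`, `0 ≤ K ≤ K′`, `0 ≤ s ≤ 1`). [folklore] -/
theorem twoConstantsLetter_mono {ε ε' K K' s : ℝ} (hε : 0 ≤ ε) (hεε : ε ≤ ε') (hK : 0 ≤ K) (hKK : K ≤ K') (hs0 : 0 ≤ s) (hs1 : s ≤ 1) :
    (ε ^ (1 - s) * K ^ s) ^ (1 - s) * K ^ s ≤ (ε' ^ (1 - s) * K' ^ s) ^ (1 - s) * K' ^ s := by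
  have h1s : 0 ≤ 1 - s := by linarith
  have hin : ε ^ (1 - s) * K ^ s ≤ ε' ^ (1 - s) * K' ^ s :=
    mul_le_mul (Real.rpow_le_rpow hε hεε h1s) (Real.rpow_le_rpow hK hKK hs0) (Real.rpow_nonneg hK _) (Real.rpow_nonneg (hε.trans hεε) _)
  have hin0 : 0 ≤ ε ^ (1 - s) * K ^ s := mul_nonneg (Real.rpow_nonneg hε _) (Real.rpow_nonneg hK _)
  exact mul_le_mul (Real.rpow_le_rpow hin0 hin h1s) (Real.rpow_le_rpow hK hKK hs0) (Real.rpow_nonneg hK _)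
    (Real.rpow_nonneg (hin0.trans hin) _)

/-- `(x^K)^y = (x^y)^K` for `x ≥ 0` (natural power inside, real power outside). [folklore] -/
theorem pow_rpow_comm {x y : ℝ} (hx : 0 ≤ x) (K : ℕ) : (x ^ K) ^ y = (x ^ y) ^ K := by
  rw [← Real.rpow_natCast x K, ← Real.rpow_mul hx, mul_comm, Real.rpow_mul hx, Real.rpow_natCast]

/-- **THE TWO-CONSTANTS LETTER OF GEOMETRIC FAMILIES IS GEOMETRIC**: `T(C₁r₀^K, M₂μ^K) = T(C₁, M₂)·ρ^K` with `ρ = (r₀^{1−s}μ^{s})^{1−s}μ^{s}` (all bases `≥ 0`). [folklore] -/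
theorem twoConstantsLetter_geometric {C₁ M₂ r₀ μ s : ℝ} (hC₁ : 0 ≤ C₁) (hM₂ : 0 ≤ M₂) (hr₀ : 0 ≤ r₀) (hμ : 0 ≤ μ) (K : ℕ) :
    ((C₁ * r₀ ^ K) ^ (1 - s) * (M₂ * μ ^ K) ^ s) ^ (1 - s) * (M₂ * μ ^ K) ^ s =
      ((C₁ ^ (1 - s) * M₂ ^ s) ^ (1 - s) * M₂ ^ s) * ((r₀ ^ (1 - s) * μ ^ s) ^ (1 - s) * μ ^ s) ^ K := by
  have hr₀K : 0 ≤ r₀ ^ K := pow_nonneg hr₀ K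
  have hμK : 0 ≤ μ ^ K := pow_nonneg hμ K
  rw [Real.mul_rpow hC₁ hr₀K, Real.mul_rpow hM₂ hμK, pow_rpow_comm hr₀, pow_rpow_comm hμ]
  have e1 : C₁ ^ (1 - s) * (r₀ ^ (1 - s)) ^ K * (M₂ ^ s * (μ ^ s) ^ K) = (C₁ ^ (1 - s) * M₂ ^ s) * ((r₀ ^ (1 - s) * μ ^ s) ^ K) := by
    rw [mul_pow]; ring
  rw [e1, Real.mul_rpow (mul_nonneg (Real.rpow_nonneg hC₁ _) (Real.rpow_nonneg hM₂ _)) (pow_nonneg (mul_nonneg (Real.rpow_nonneg hr₀ _) (Real.rpow_nonneg hμ _)) K),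
    pow_rpow_comm (mul_nonneg (Real.rpow_nonneg hr₀ _) (Real.rpow_nonneg hμ _)), mul_pow]
  ring

end Algebra

section RealFlat

variable {ι : Type*} [Fintype ι]

/-- **TWO VOLUMES COMPARED ON THE COMMON PLANE FROM REAL FLATNESS + A COMPLEX BOUND.**  Colour by colour, the two-point complex generating functions `g_A c`, `g_B c` are holomorphic on
the bidisc `‖σ‖ < R`, their DIFFERENCE is bounded by `K` on the closed bidisc of radius `L < R` and REAL-FLAT there (`‖g_A c(a,b) − g_B c(a,b)‖ ≤ ε` for real `|a|,|b| ≤ L`; `0 < ε ≤ K`,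
`0 < s < 1`).  Then the colour averages of the kernels differ by at most `16·T(ε,K)∕(Ls∕4)²`, `T(ε,K) = (ε^{1−s}K^{s})^{1−s}K^{s}` — §1 on the difference, then the schema file's
`abs_avg_polTensor_twoPoint_sub_le` (J28's Cauchy bound on the plane) on the bidisc of radius `Ls∕4`. [cite: Balaban1987RG1, (1.20)-(1.21) p.264] [cite: Chae1985, Ch. 15 (Cauchy estimates)] -/
theorem abs_avg_polTensor_twoPoint_sub_le_of_realFlat (gA gB : ι → (Fin 2 → ℂ) → ℂ) {R L K ε s : ℝ} (hL : 0 < L) (hLR : L < R)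
    (hε : 0 < ε) (hεK : ε ≤ K) (hs0 : 0 < s) (hs1 : s < 1)
    (hgA : ∀ c, DifferentiableOn ℂ (gA c) (ball 0 R)) (hgB : ∀ c, DifferentiableOn ℂ (gB c) (ball 0 R))
    (hK : ∀ c, ∀ σ ∈ closedBall (0 : Fin 2 → ℂ) L, ‖gA c σ - gB c σ‖ ≤ K)
    (hflat : ∀ c (a b : ℝ), |a| ≤ L → |b| ≤ L → ‖gA c ![(a : ℂ), (b : ℂ)] - gB c ![(a : ℂ), (b : ℂ)]‖ ≤ ε) :
    |(Fintype.card ι : ℝ)⁻¹ * ∑ c, polTensor ℝ (fun p : Unit → Fin 2 → ℝ => (gA c (fun i => (p () i : ℂ))).re) () 0 1 () 1 1 -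
      (Fintype.card ι : ℝ)⁻¹ * ∑ c, polTensor ℝ (fun p : Unit → Fin 2 → ℝ => (gB c (fun i => (p () i : ℂ))).re) () 0 1 () 1 1| ≤
      16 * ((ε ^ (1 - s) * K ^ s) ^ (1 - s) * K ^ s) / (L * s / 4) ^ 2 := by
  have hK0 : 0 < K := hε.trans_le hεK
  have hr₂ : 0 < L * s / 4 := by positivity
  have hsub : ball (0 : Fin 2 → ℂ) (L * s / 4) ⊆ ball 0 R := ball_subset_ball (by nlinarith)
  have hT : 0 ≤ (ε ^ (1 - s) * K ^ s) ^ (1 - s) * K ^ s :=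
    mul_nonneg (Real.rpow_nonneg (mul_nonneg (Real.rpow_nonneg hε.le _) (Real.rpow_nonneg hK0.le _)) _) (Real.rpow_nonneg hK0.le _)
  refine abs_avg_polTensor_twoPoint_sub_le gA gB hr₂ hT (fun c => (hgA c).mono hsub) (fun c => (hgB c).mono hsub) fun c σ hσ => ?_
  exact norm_le_twoConstants_bidisc (fun σ => gA c σ - gB c σ) hL hLR ((hgA c).sub (hgB c)) (hK c) (hflat c) hε hεK hs1 (le_of_lt (mem_ball_zero_iff.1 hσ))

end RealFlat


end YMDAG.N22.AtKernels

end
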